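import Literature.Probability.Percolation.SlabGluingFact2Core
import HarnessLib

/-!
# Newman–Tassion–Wu 2017, §3.2 — the gluing lemmas for slabs: the geometry-free core of the
# local surgery in general position

Topic: `Literature/Probability/Percolation`. First file of a port of §3 ("RSW theory and power law
decay on slabs") of Newman–Tassion–Wu, *Critical percolation and the minimal spanning tree in
slabs* (CPAM 70 (2017); arXiv:1512.09107), whose Theorem 3.1 is the box-crossing property at
`p_c(S_k)` for every slab `S_k = ℤ² × {0,…,k}`. The engine of §3 is the **gluing lemma**
(Thm. 3.7, "main gluing lemma for paths"; Thm. 3.6 = GL0): an open path from `C̄` that comes close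
to the minimal open path `Γ = Γ_min^S(A,B)` from `Ā` to `B̄` inside `S̄` can be GLUED to it by a
local surgery, at a price depending only on `p` and `k`, and the surgery can be RECOVERED from the
new configuration through the statistic "the vertices of `Γ_min` joined to `C̄` off `Γ_min`"
(proof of Thm. 3.7, steps (1)–(3) and the sentence "`z` is the only site in the new minimal path
… that is connected to `C` without using any edge in `Γ(ω^{(z)})`", pp. 9–10 of the arXiv text).

The tree already holds this engine in the special geometry of Duminil-Copin–Sidoravicius–Tassion
2016 (`GlueGeom.Surgery`, `SlabGluingFact2Core.lean`: cleared columns inside `B_{3n} ∪ B'_n`,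
source `S̄_{3n}`, target `Z̄_n`, far side `S̄'_n`). This file re-does it for the GENERAL data of
NTW's Theorem 3.7 — planar domains `S ⊆ R`, source `A`, target `B`, far set `C` (`GlueData`) —
with one structural change needed in general position: the branch attached to the rerouted
minimal path ends with a **port edge** to a vertex `q₁` OUTSIDE the cleared columns `D̄` that is
`ω`-joined to `C̄` inside `R̄ ∖ D̄` (so the surgery also works when the `C`-cluster only comes
NEXT to the cleared box, e.g. along `B̄` or along `∂R`, where the box cannot be enlarged).

* `GlueData`, `GlueData.γ` (`= minPath` from `Ā` to `B̄` inside `S̄`), the events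
  `evAB = {Ā ⟷^{S̄} B̄}`, `evCA = {C̄ ⟷^{R̄} Ā}`, `evX = evAB ∖ evCA`.
* `GlueData.Surgery Q k ω` — the data of one surgery: cleared planar set `D ⊆ R ∖ (A ∪ B)`; the
  decomposition `γ = p₀ ++ E₁ :: mid ++ E₂ :: s₀` at the first/last visits of `D̄`; the rerouted
  piece `P` (inside `D̄ ∩ S̄`); the junction `c ∈ E₁ :: P`; the branch `Br ⊆ D̄` and the port
  vertex `q₁ ∉ D̄` with `c :: Br ++ [q₁]` a self-avoiding lattice chain off the rerouted piece;
  the forward condition `key (successor of c) < key ((Br ++ [q₁]).head)` (NTW's "`v ≺ w`");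
  an `ω`-open path from `q₁` to `C̄` inside `R̄ ∖ D̄`.
* `Surgery.newConfig` — `ω^{(z)}`: close every pair touching `D̄`, open the rerouted piece, the
  branch with its port edge, and the two edges of `γ` into `E₁` / out of `E₂`.
* PROVED: `exists_tail` (`Γ_min(ω^{(z)}) = p₀ ++ E₁ :: P ++ E₂ :: tail`, by the tree's exchange
  lemma `minPath_prefix_of_surgery`), `tail_props` (the continuation lives in the old world),
  `c_mem_att` and `att_subset` (the statistic `att` — vertices of `Γ_min(ω')` joined to `C̄`
  inside `R̄` avoiding the rest of `Γ_min(ω')` — contains `c` and lies in `D̄`),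
  `newConfig_mem_evCA` (`ω^{(z)} ∈ {C̄ ⟷^{R̄} Ā}`), `mem_newConfig_iff_of_not_touch` (locality).

What this file does NOT do: choose `D` and route `P`, `Br` (the geometric layer, next files), and
the probabilistic bookkeeping (Lemma 3.5 = the tree's `lemma7_bond`).

## Sources

* C. M. Newman, V. Tassion, W. Wu, *Critical percolation and the minimal spanning tree in slabs*,
  Comm. Pure Appl. Math. 70 (2017), 2084–2120, arXiv:1512.09107: §3.2, Definition 3.1,
  Theorems 3.6–3.7 and the proof of Theorem 3.7 (Facts 1–2, steps (1)–(3), the recovery sentence;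
  pp. 8–10 of the arXiv text, `lit read arxiv:1512.09107` p0008–p0010) [NewmanTassionWu2017].
* H. Duminil-Copin, V. Sidoravicius, V. Tassion, *Absence of infinite cluster for critical
  Bernoulli percolation on slabs*, CPAM 69 (2016), §2.3 (the same surgery in special geometry; the
  tree's `SlabGluingFact2Core.lean`, whose lemma list this file follows).

## Design choices

* `S ⊆ R` is part of the data: Theorem 3.7 as printed (no relation between `R` and `S`) is false
  (`S = [0,10]²`, `R = [10,20] × [0,10]`, `A, B` the left/right sides of `S`, `C` the right side of
  `R`: `C̄ ⟷^{R̄} N(Γ̄, r)` has probability `≍ f(10,10) > 0` while `Ā ∩ R̄ = ∅`); every use of it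
  in §3 has `S ⊆ R`.
* `D ∩ (A ∪ B) = ∅` is part of the data: then `γ` starts and ends off `D̄` (`p₀, s₀ ≠ []`), the
  rerouted piece avoids `B̄`, and no structure vertex lies in `Ā` — which removes the gap in the
  printed recovery sentence (an open self-avoiding path STARTING at an `Ā`-vertex of the structure
  with a key below `Γ₀`'s; cf. the "Design choices" of `SlabGluingRouting.lean`). Contacts near
  `Ā` are treated by a second, simpler surgery (gluing the `C`-cluster directly to `Ā`) in a later
  file.
* The far-side path is recorded only as `ω ∈ openConnIn ((R ∖ D)‾) q₁ cC`; that it avoids `γ` and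
  the continuation `tail` is DERIVED from `ω ∉ evCA`.
-/

noncomputable section

namespace Literature.Probability.Percolation

open MeasureTheory LatticeModels SimpleGraph Filter Topology

namespace NTW17

/-! ## Restricting an open connection to the vertices it can reach -/

section OpenConn

variable {V : Type*}

/-- An open connection inside `S` from `x` runs through vertices that are themselves joined to `x`
inside `S`; so it is an open connection inside `S ∩ T` as soon as every vertex of `S` joined to
`x` inside `S` lies in `T`. [cite: NewmanTassionWu2017, §3.2 (proof of Theorem 3.7)] -/
theorem openConnIn_inter_of_forall {S T : Set V} {ω : BondConfig V} {x y : V}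
    (h : ω ∈ openConnIn S x y) (hT : ∀ v ∈ S, ω ∈ openConnIn S x v → v ∈ T) :
    ω ∈ openConnIn (S ∩ T) x y := by
  rw [mem_openConnIn_iff_pathIn] at h ⊢
  obtain ⟨hx, h⟩ := h
  have hxT : x ∈ T := hT x hx (openConnIn_refl hx)
  refine ⟨⟨hx, hxT⟩, ?_⟩
  induction h with
  | refl => exact Relation.ReflTransGen.refl
  | @tail b c hab hbc ih =>
    refine Relation.ReflTransGen.tail ih ⟨hbc.1, hbc.2, hT c hbc.2 ?_⟩
    rw [mem_openConnIn_iff_pathIn]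
    exact ⟨hx, hab.tail hbc⟩

/-- An open connection inside `S` for `ω` is one for any configuration containing all the pairs of
`ω` inside `S`. [cite: NewmanTassionWu2017, §3.2 (proof of Theorem 3.7)] -/
theorem openConnIn_of_subset_on {S : Set V} {ω ω' : BondConfig V} {x y : V}
    (h : ω ∈ openConnIn S x y) (hsub : ∀ a ∈ S, ∀ b ∈ S, s(a, b) ∈ ω → s(a, b) ∈ ω') :
    ω' ∈ openConnIn S x y := by
  rw [mem_openConnIn_iff_pathIn] at h ⊢
  obtain ⟨hx, h⟩ := h
  refine ⟨hx, ?_⟩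
  induction h with
  | refl => exact Relation.ReflTransGen.refl
  | @tail b c hab hbc ih =>
    have hb : b ∈ S := by
      have : PathIn (openGraph ω) S x b := ⟨hx, hab⟩
      exact this.right_mem
    refine Relation.ReflTransGen.tail ih ⟨?_, hbc.2⟩
    rw [openGraph_adj] at hbc ⊢
    exact ⟨hsub b hb c hbc.2 hbc.1.1, hbc.1.2⟩

end OpenConn

/-! ## The data of a gluing problem and its events -/

section Data

/-- **The data of NTW's gluing lemma** (Thm. 3.7): planar domains `S ⊆ R` (finite), the source
`A` and target `B` of the minimal path (inside `S̄`), and the set `C` to be glued (connections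
inside `R̄`). All sets are planar; the events use their lifts `Ā = A × {0,…,k}`.
[cite: NewmanTassionWu2017, §3.2 (Theorem 3.7, the sets S, R, A, B, C)] -/
structure GlueData where
  /-- the domain of the minimal path -/
  S : Set (ℤ × ℤ)
  /-- the domain of the glued connection -/
  R : Set (ℤ × ℤ)
  /-- the source of the minimal path -/
  A : Set (ℤ × ℤ)
  /-- the target of the minimal path -/
  B : Set (ℤ × ℤ)
  /-- the set to be glued to `A` -/
  C : Set (ℤ × ℤ)
  /-- `S ⊆ R` -/
  hSR : S ⊆ R
  /-- `S` is finite -/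
  hSfin : S.Finite
  /-- `R` is finite -/
  hRfin : R.Finite

namespace GlueData

variable (Q : GlueData) (k : ℕ)

/-- **`Γ = Γ_min^S(A, B)`**: the minimal open self-avoiding path from `Ā` to `B̄` inside `S̄` (the
tree's `minPath`, vertex-lexicographic order `pathKey`).
[cite: NewmanTassionWu2017, §3.2 (definition of Γ_min^S(A,B))] -/
def γ (ω : BondConfig (slab 3 k)) : List (slab 3 k) :=
  minPath k ω (slabLift k Q.S) (slabLift k Q.A) (slabLift k Q.B)

/-- The event `A ⟷^S B` (an open path from `Ā` to `B̄` inside `S̄`).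
[cite: NewmanTassionWu2017, §3.2 (the event A ↔^S B)] -/
def evAB : Set (BondConfig (slab 3 k)) := slabConn k Q.S Q.A Q.B

/-- The event `C ⟷^R A` (the glued connection). [cite: NewmanTassionWu2017, §3.2 (Theorem 3.7, the event C ↔^R A)] -/
def evCA : Set (BondConfig (slab 3 k)) := slabConn k Q.R Q.C Q.A

/-- The configurations on which a surgery is performed: `Γ` exists and `C` is not yet glued to
`A` (NTW's `𝒳` is the part of this event where `C` comes close to `Γ̄`).
[cite: NewmanTassionWu2017, §3.2 (proof of Theorem 3.7, the event 𝒳)] -/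
def evX : Set (BondConfig (slab 3 k)) := Q.evAB k ∩ (Q.evCA k)ᶜ

variable {Q k}

/-- `S̄` is finite. [cite: NewmanTassionWu2017, §3.2 (proof of Theorem 3.7)] -/
theorem S_finite : (slabLift k Q.S).Finite := slabLift_finite k Q.hSfin

/-- On `A ⟷^S B`, `Γ` is an open self-avoiding path from `Ā` to `B̄` inside `S̄` with minimal key.
[cite: NewmanTassionWu2017, §3.2 (definition of Γ_min)] -/
theorem γ_spec {ω : BondConfig (slab 3 k)} (hA : ω ∈ Q.evAB k) :
    IsOSAP k ω (slabLift k Q.S) (slabLift k Q.A) (slabLift k Q.B) (Q.γ k ω) ∧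
      ∀ l, IsOSAP k ω (slabLift k Q.S) (slabLift k Q.A) (slabLift k Q.B) l →
        pathKey k (Q.γ k ω) ≤ pathKey k l :=
  minPath_spec Q.S_finite ((mem_slabConn_iff_exists_isOSAP ω _ _ _).1 hA)

/-- `evX ⊆ evAB`. [cite: NewmanTassionWu2017, §3.2 (proof of Theorem 3.7)] -/
theorem evAB_of_evX {ω : BondConfig (slab 3 k)} (hX : ω ∈ Q.evX k) : ω ∈ Q.evAB k := hX.1

/-- On `evX`, no vertex of `Ā` is joined inside `R̄` to a vertex of `C̄`. [cite: NewmanTassionWu2017, §3.2 (proof of Theorem 3.7)] -/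
theorem not_joined_of_evX {ω : BondConfig (slab 3 k)} (hX : ω ∈ Q.evX k) {a c : slab 3 k}
    (ha : a ∈ slabLift k Q.A) (hc : c ∈ slabLift k Q.C) (h : ω ∈ openConnIn (slabLift k Q.R) a c) :
    False :=
  hX.2 ⟨c, hc, a, ha, openConnIn_reverse h⟩

/-- Every vertex of `Γ` is joined to `Γ₀ ∈ Ā` inside `R̄`. [cite: NewmanTassionWu2017, §3.2 (proof of Theorem 3.7)] -/
theorem joined_head_of_mem_γ {ω : BondConfig (slab 3 k)} (hA : ω ∈ Q.evAB k) {v : slab 3 k}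
    (hv : v ∈ Q.γ k ω) :
    ω ∈ openConnIn (slabLift k Q.R) ((Q.γ k ω).head (Q.γ_spec hA).1.ne_nil) v :=
  openConnIn_mono (slabLift_mono k Q.hSR) _ _ ((Q.γ_spec hA).1.openConnIn_of_mem hv)

/-- `Γ₀ ∈ Ā`. [cite: NewmanTassionWu2017, §3.2 (proof of Theorem 3.7)] -/
theorem γ_head_mem {ω : BondConfig (slab 3 k)} (hA : ω ∈ Q.evAB k) :
    (Q.γ k ω).head (Q.γ_spec hA).1.ne_nil ∈ slabLift k Q.A :=
  (Q.γ_spec hA).1.head_mem _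

/-- On `evX`, no vertex of `Γ` is joined inside `R̄` to `C̄`. [cite: NewmanTassionWu2017, §3.2 (proof of Theorem 3.7)] -/
theorem not_joined_γ_of_evX {ω : BondConfig (slab 3 k)} (hX : ω ∈ Q.evX k) {v c : slab 3 k}
    (hv : v ∈ Q.γ k ω) (hc : c ∈ slabLift k Q.C) (h : ω ∈ openConnIn (slabLift k Q.R) v c) :
    False :=
  Q.not_joined_of_evX hX (Q.γ_head_mem hX.1) hc
    (SlabCriticality.openConnIn_trans (Q.joined_head_of_mem_γ hX.1 hv) h)

end GlueData

end Data

/-! ## The data of one surgery -/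

section SurgeryData

variable (k : ℕ)

/-- **The data of one local surgery in general position** (NTW 2017, proof of Thm. 3.7, steps
(1)–(3); DST 2016, proof of Fact 2). For `ω ∈ evX` with
`γ = p₀ ++ E₁ :: mid ++ E₂ :: s₀`: a cleared planar set `D ⊆ R` avoiding `A` and `B`, met by `γ`
first at `E₁` and last at `E₂` (`p₀, s₀ ≠ []` off `D̄`); a rerouted piece `P` inside `D̄ ∩ S̄` with
`E₁ :: P ++ [E₂]` a self-avoiding lattice chain; a junction `c ∈ E₁ :: P`; a branch `Br ⊆ D̄` and a
port vertex `q₁ ∉ D̄` with `c :: Br ++ [q₁]` a self-avoiding lattice chain meeting the rerouted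
piece only at `c`; the forward condition "`v ≺ w`" as
`key (successor of c) < key ((Br ++ [q₁]).head)`; and an `ω`-open path from `q₁` to a vertex
`cC ∈ C̄` inside `R̄ ∖ D̄`.
[cite: NewmanTassionWu2017, §3.2 (proof of Theorem 3.7, steps (1)–(3))] -/
structure GlueData.Surgery (Q : GlueData) (ω : BondConfig (slab 3 k)) where
  /-- the cleared columns -/
  D : Set (ℤ × ℤ)
  /-- `γ` before its first visit to `D̄` -/
  p₀ : List (slab 3 k)
  /-- the first vertex of `γ` in `D̄` -/
  E₁ : slab 3 k
  /-- `γ` strictly between `E₁` and `E₂` -/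
  mid : List (slab 3 k)
  /-- the last vertex of `γ` in `D̄` -/
  E₂ : slab 3 k
  /-- `γ` after its last visit to `D̄` -/
  s₀ : List (slab 3 k)
  /-- the rerouted piece (strictly between `E₁` and `E₂`) -/
  P : List (slab 3 k)
  /-- the junction -/
  c : slab 3 k
  /-- the branch (inside `D̄`, possibly empty) -/
  Br : List (slab 3 k)
  /-- the port vertex (outside `D̄`) -/
  q₁ : slab 3 k
  /-- the far vertex, in `C̄` -/
  cC : slab 3 k
  hDR : D ⊆ Q.R
  hDA : ∀ z ∈ D, z ∉ Q.A
  hDB : ∀ z ∈ D, z ∉ Q.B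
  hγ : Q.γ k ω = p₀ ++ E₁ :: (mid ++ E₂ :: s₀)
  hp₀ : p₀ ≠ []
  hs₀ : s₀ ≠ []
  hp₀D : ∀ x ∈ p₀, planar k x ∉ D
  hs₀D : ∀ x ∈ s₀, planar k x ∉ D
  hE₁D : planar k E₁ ∈ D
  hE₂D : planar k E₂ ∈ D
  hPD : ∀ x ∈ P, planar k x ∈ D
  hPS : ∀ x ∈ P, planar k x ∈ Q.S
  hSPchain : (E₁ :: (P ++ [E₂])).IsChain (fun a b => (slabGraph 3 k).Adj a b)
  hSPnodup : (E₁ :: (P ++ [E₂])).Nodup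
  hc : c ∈ E₁ :: P
  hBrD : ∀ x ∈ Br, planar k x ∈ D
  hq₁D : planar k q₁ ∉ D
  hBchain : (c :: (Br ++ [q₁])).IsChain (fun a b => (slabGraph 3 k).Adj a b)
  hBnodup : (c :: (Br ++ [q₁])).Nodup
  hBrSP : ∀ x ∈ Br, x ∉ E₁ :: (P ++ [E₂])
  hfwd : ∀ (l₁ l₂ : List (slab 3 k)) (y : slab 3 k), E₁ :: (P ++ [E₂]) = l₁ ++ c :: y :: l₂ →
    vKey k y < vKey k ((Br ++ [q₁]).head (by simp))
  hcC : cC ∈ slabLift k Q.C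
  hσ : ω ∈ openConnIn (slabLift k (Q.R \ D)) q₁ cC

namespace GlueData.Surgery

variable {k} {Q : GlueData} {ω : BondConfig (slab 3 k)} (sx : Q.Surgery k ω)

/-- The rerouted structure path `E₁ :: P ++ [E₂]`. [cite: NewmanTassionWu2017, §3.2 (proof of Theorem 3.7, step (3))] -/
def SP : List (slab 3 k) := sx.E₁ :: (sx.P ++ [sx.E₂])

/-- The branch followed by the port vertex. [cite: NewmanTassionWu2017, §3.2 (proof of Theorem 3.7, step (3), the path γ_w)] -/
def BQ : List (slab 3 k) := sx.Br ++ [sx.q₁]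

/-- The new (opened) edges: those of the rerouted piece and of the branch with its port edge.
[cite: NewmanTassionWu2017, §3.2 (proof of Theorem 3.7, step (3) "Open the edges …")] -/
def structEdges : Set (Sym2 (slab 3 k)) := edgesOf sx.SP ∪ edgesOf (sx.c :: sx.BQ)

/-- The kept edges of `γ` entering `D̄`: into `E₁` and out of `E₂`.
[cite: NewmanTassionWu2017, §3.2 (proof of Theorem 3.7, step (2) "except the edges … which are in Γ(ω)")] -/
def stubs : Set (Sym2 (slab 3 k)) :=
  {s(sx.p₀.getLast sx.hp₀, sx.E₁), s(sx.E₂, sx.s₀.head sx.hs₀)}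

/-- **The new configuration `ω^{(z)}`**: close every pair touching `D̄`, then open the structure
edges and the two stubs. [cite: NewmanTassionWu2017, §3.2 (proof of Theorem 3.7, steps (2)–(3))] -/
def newConfig : BondConfig (slab 3 k) := (ω \ touch k sx.D) ∪ sx.structEdges ∪ sx.stubs

/-- The protected structure vertices (inside `D̄`): the rerouted path and the branch.
[cite: NewmanTassionWu2017, §3.2 (proof of Theorem 3.7)] -/
def Wv : Set (slab 3 k) := {x | x ∈ sx.SP ∨ x ∈ sx.Br}

/-- All structure vertices: the protected ones and the port vertex.
[cite: NewmanTassionWu2017, §3.2 (proof of Theorem 3.7)] -/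
def Sw : Set (slab 3 k) := {x | x ∈ sx.Wv ∨ x = sx.q₁}

/-! ### Elementary consequences of the data -/

/-- `BQ ≠ []`. [cite: NewmanTassionWu2017, §3.2 (proof of Theorem 3.7)] -/
theorem BQ_ne_nil : sx.BQ ≠ [] := by simp [BQ]

/-- `Wv ⊆ Sw`. [cite: NewmanTassionWu2017, §3.2 (proof of Theorem 3.7)] -/
theorem Wv_subset : sx.Wv ⊆ sx.Sw := fun _ h => Or.inl h

/-- `E₁` lies on the structure path. [cite: NewmanTassionWu2017, §3.2 (proof of Theorem 3.7)] -/
theorem E₁_mem_SP : sx.E₁ ∈ sx.SP := by simp [SP]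

/-- `E₂` lies on the structure path. [cite: NewmanTassionWu2017, §3.2 (proof of Theorem 3.7)] -/
theorem E₂_mem_SP : sx.E₂ ∈ sx.SP := by simp [SP]

/-- `c` lies on the structure path. [cite: NewmanTassionWu2017, §3.2 (proof of Theorem 3.7)] -/
theorem c_mem_SP : sx.c ∈ sx.SP := by
  rcases List.mem_cons.1 sx.hc with h | h
  · rw [h]; exact sx.E₁_mem_SP
  · simp [SP, h]

/-- Membership in the structure path. [cite: NewmanTassionWu2017, §3.2 (proof of Theorem 3.7)] -/
theorem mem_SP_iff {x : slab 3 k} : x ∈ sx.SP ↔ x = sx.E₁ ∨ x ∈ sx.P ∨ x = sx.E₂ := by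
  simp [SP]

/-- The structure path lies in `D̄`. [cite: NewmanTassionWu2017, §3.2 (proof of Theorem 3.7)] -/
theorem SP_D {x : slab 3 k} (hx : x ∈ sx.SP) : planar k x ∈ sx.D := by
  rcases sx.mem_SP_iff.1 hx with rfl | h | rfl
  · exact sx.hE₁D
  · exact sx.hPD x h
  · exact sx.hE₂D

/-- Protected vertices lie in `D̄`. [cite: NewmanTassionWu2017, §3.2 (proof of Theorem 3.7)] -/
theorem Wv_D {x : slab 3 k} (hx : x ∈ sx.Wv) : planar k x ∈ sx.D := by
  rcases hx with h | h
  · exact sx.SP_D h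
  · exact sx.hBrD x h

/-- The port vertex is not protected. [cite: NewmanTassionWu2017, §3.2 (proof of Theorem 3.7)] -/
theorem q₁_not_Wv : sx.q₁ ∉ sx.Wv := fun h => sx.hq₁D (sx.Wv_D h)

/-- The port vertex is a structure vertex. [cite: NewmanTassionWu2017, §3.2 (proof of Theorem 3.7)] -/
theorem q₁_mem_Sw : sx.q₁ ∈ sx.Sw := Or.inr rfl

/-- A structure vertex in `D̄` is protected. [cite: NewmanTassionWu2017, §3.2 (proof of Theorem 3.7)] -/
theorem mem_Wv_of_Sw_D {x : slab 3 k} (hx : x ∈ sx.Sw) (hD : planar k x ∈ sx.D) : x ∈ sx.Wv := by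
  rcases hx with h | rfl
  · exact h
  · exact absurd hD sx.hq₁D

/-- The junction is not `E₂`. [cite: NewmanTassionWu2017, §3.2 (proof of Theorem 3.7)] -/
theorem c_ne_E₂ : sx.c ≠ sx.E₂ := by
  intro h
  have hnd := sx.hSPnodup
  rcases List.mem_cons.1 sx.hc with h1 | h1
  · rw [h1] at h
    rw [h] at hnd
    exact (List.nodup_cons.1 hnd).1 (by simp)
  · rw [h] at h1
    have := (List.nodup_cons.1 hnd).2
    rw [List.nodup_append] at this
    exact this.2.2 _ h1 _ (by simp) rfl

/-- `E₁ ≠ E₂`. [cite: NewmanTassionWu2017, §3.2 (proof of Theorem 3.7)] -/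
theorem E₁_ne_E₂ : sx.E₁ ≠ sx.E₂ := by
  intro h
  have hnd := sx.hSPnodup
  rw [h] at hnd
  exact (List.nodup_cons.1 hnd).1 (by simp)

/-- The port vertex is off the structure path. [cite: NewmanTassionWu2017, §3.2 (proof of Theorem 3.7)] -/
theorem q₁_not_mem_SP : sx.q₁ ∉ sx.SP := fun h => sx.hq₁D (sx.SP_D h)

/-- Vertices of `BQ` are off the structure path. [cite: NewmanTassionWu2017, §3.2 (proof of Theorem 3.7)] -/
theorem BQ_not_SP {x : slab 3 k} (hx : x ∈ sx.BQ) : x ∉ sx.SP := by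
  rcases List.mem_append.1 hx with h | h
  · exact sx.hBrSP x h
  · rw [List.mem_singleton] at h
    rw [h]; exact sx.q₁_not_mem_SP

/-- `c ∉ BQ`. [cite: NewmanTassionWu2017, §3.2 (proof of Theorem 3.7)] -/
theorem c_not_BQ : sx.c ∉ sx.BQ := fun h => sx.BQ_not_SP h sx.c_mem_SP

/-- The last vertex of `p₀` is off `D̄`. [cite: NewmanTassionWu2017, §3.2 (proof of Theorem 3.7)] -/
theorem p₀_last_not_D : planar k (sx.p₀.getLast sx.hp₀) ∉ sx.D := sx.hp₀D _ (List.getLast_mem _)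

/-- The first vertex of `s₀` is off `D̄`. [cite: NewmanTassionWu2017, §3.2 (proof of Theorem 3.7)] -/
theorem s₀_head_not_D : planar k (sx.s₀.head sx.hs₀) ∉ sx.D := sx.hs₀D _ (List.head_mem _)

/-- The new edges join structure vertices. [cite: NewmanTassionWu2017, §3.2 (proof of Theorem 3.7)] -/
theorem structEdges_Sw {a b : slab 3 k} (h : s(a, b) ∈ sx.structEdges) : a ∈ sx.Sw ∧ b ∈ sx.Sw := by
  rcases h with h | h
  · obtain ⟨ha, hb⟩ := mem_of_mem_edgesOf h
    exact ⟨Or.inl (Or.inl ha), Or.inl (Or.inl hb)⟩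
  · obtain ⟨ha, hb⟩ := mem_of_mem_edgesOf h
    have aux : ∀ x ∈ sx.c :: sx.BQ, x ∈ sx.Sw := by
      intro x hx
      rcases List.mem_cons.1 hx with rfl | hx
      · exact Or.inl (Or.inl sx.c_mem_SP)
      · rcases List.mem_append.1 hx with hx | hx
        · exact Or.inl (Or.inr hx)
        · rw [List.mem_singleton] at hx
          exact Or.inr hx
    exact ⟨aux a ha, aux b hb⟩

/-- `γ` in decomposed form is an open self-avoiding path. [cite: NewmanTassionWu2017, §3.2 (proof of Theorem 3.7)] -/
theorem γ_isOSAP (hA : ω ∈ Q.evAB k) :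
    IsOSAP k ω (slabLift k Q.S) (slabLift k Q.A) (slabLift k Q.B)
      (sx.p₀ ++ sx.E₁ :: (sx.mid ++ sx.E₂ :: sx.s₀)) := by
  have := (Q.γ_spec hA).1
  rw [show Q.γ k ω = _ from sx.hγ] at this
  exact this

/-- The edge of `γ` into `E₁` is open. [cite: NewmanTassionWu2017, §3.2 (proof of Theorem 3.7)] -/
theorem γ_rel_p₀_E₁ (hA : ω ∈ Q.evAB k) :
    s(sx.p₀.getLast sx.hp₀, sx.E₁) ∈ ω ∧ sx.p₀.getLast sx.hp₀ ≠ sx.E₁ := by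
  have hch := (sx.γ_isOSAP hA).chain
  exact List.IsChain.rel_getLast_head_of_append hch sx.hp₀ (by simp)

/-- The edge of `γ` out of `E₂` is open. [cite: NewmanTassionWu2017, §3.2 (proof of Theorem 3.7)] -/
theorem γ_rel_E₂_s₀ (hA : ω ∈ Q.evAB k) :
    s(sx.E₂, sx.s₀.head sx.hs₀) ∈ ω ∧ sx.E₂ ≠ sx.s₀.head sx.hs₀ := by
  have hch := (sx.γ_isOSAP hA).chain
  have h1 : ((sx.p₀ ++ sx.E₁ :: sx.mid ++ [sx.E₂]) ++ sx.s₀).IsChain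
      (fun a b => s(a, b) ∈ ω ∧ a ≠ b) := by
    convert hch using 1; simp
  have h2 := List.IsChain.rel_getLast_head_of_append h1 (by simp) sx.hs₀
  simpa using h2

/-- The chain `s₀` is open. [cite: NewmanTassionWu2017, §3.2 (proof of Theorem 3.7)] -/
theorem γ_chain_s₀ (hA : ω ∈ Q.evAB k) : sx.s₀.IsChain (fun a b => s(a, b) ∈ ω ∧ a ≠ b) := by
  have hch := (sx.γ_isOSAP hA).chain
  have h1 : ((sx.p₀ ++ sx.E₁ :: sx.mid ++ [sx.E₂]) ++ sx.s₀).IsChain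
      (fun a b => s(a, b) ∈ ω ∧ a ≠ b) := by
    convert hch using 1; simp
  exact (List.isChain_append.1 h1).2.1

/-- The stubs are `ω`-open. [cite: NewmanTassionWu2017, §3.2 (proof of Theorem 3.7)] -/
theorem stubs_subset (hA : ω ∈ Q.evAB k) : sx.stubs ⊆ ω := by
  rintro e (rfl | rfl)
  · exact (sx.γ_rel_p₀_E₁ hA).1
  · exact (sx.γ_rel_E₂_s₀ hA).1

/-- The endpoints of a stub. [cite: NewmanTassionWu2017, §3.2 (proof of Theorem 3.7)] -/
theorem stubs_cases {q x : slab 3 k} (h : s(q, x) ∈ sx.stubs) :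
    (x = sx.E₁ ∧ q = sx.p₀.getLast sx.hp₀) ∨ (q = sx.E₁ ∧ x = sx.p₀.getLast sx.hp₀) ∨
    (x = sx.E₂ ∧ q = sx.s₀.head sx.hs₀) ∨ (q = sx.E₂ ∧ x = sx.s₀.head sx.hs₀) := by
  rcases h with h | h
  · rcases Sym2.eq_iff.1 h with ⟨rfl, rfl⟩ | ⟨rfl, rfl⟩
    · exact Or.inl ⟨rfl, rfl⟩
    · exact Or.inr (Or.inl ⟨rfl, rfl⟩)
  · rcases Sym2.eq_iff.1 h with ⟨rfl, rfl⟩ | ⟨rfl, rfl⟩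
    · exact Or.inr (Or.inr (Or.inr ⟨rfl, rfl⟩))
    · exact Or.inr (Or.inr (Or.inl ⟨rfl, rfl⟩))

/-- A stub entering a vertex of `D̄` enters `E₁` or `E₂`, from its fixed partner. [cite: NewmanTassionWu2017, §3.2 (proof of Theorem 3.7)] -/
theorem stubs_cases_D {q x : slab 3 k} (h : s(q, x) ∈ sx.stubs) (hx : planar k x ∈ sx.D) :
    (x = sx.E₁ ∧ q = sx.p₀.getLast sx.hp₀) ∨ (x = sx.E₂ ∧ q = sx.s₀.head sx.hs₀) := by
  rcases sx.stubs_cases h with h | ⟨-, rfl⟩ | h | ⟨-, rfl⟩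
  · exact Or.inl h
  · exact absurd hx sx.p₀_last_not_D
  · exact Or.inr h
  · exact absurd hx sx.s₀_head_not_D

/-- Stubs touch `D̄`. [cite: NewmanTassionWu2017, §3.2 (proof of Theorem 3.7)] -/
theorem stubs_touch : sx.stubs ⊆ touch k sx.D := by
  intro e he
  induction e using Sym2.ind with
  | h q x =>
    rcases sx.stubs_cases he with ⟨rfl, -⟩ | ⟨rfl, -⟩ | ⟨rfl, -⟩ | ⟨rfl, -⟩
    · exact mk_mem_touch_iff.2 (Or.inr sx.hE₁D)
    · exact mk_mem_touch_iff.2 (Or.inl sx.hE₁D)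
    · exact mk_mem_touch_iff.2 (Or.inr sx.hE₂D)
    · exact mk_mem_touch_iff.2 (Or.inl sx.hE₂D)

/-- Every structure edge has a protected endpoint. [cite: NewmanTassionWu2017, §3.2 (proof of Theorem 3.7)] -/
theorem structEdges_Wv {a b : slab 3 k} (h : s(a, b) ∈ sx.structEdges) : a ∈ sx.Wv ∨ b ∈ sx.Wv := by
  rcases h with h | h
  · exact Or.inl (Or.inl (mem_of_mem_edgesOf h).1)
  · -- an edge of `c :: Br ++ [q₁]`: two distinct consecutive vertices, not both `q₁`
    obtain ⟨ha, hb⟩ := mem_of_mem_edgesOf h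
    have hab : a ≠ b :=
      ((SimpleGraph.mem_edgeSet (slabGraph 3 k)).1 (edgesOf_subset_edgeSet sx.hBchain h)).ne
    have aux : ∀ x ∈ sx.c :: sx.BQ, x ≠ sx.q₁ → x ∈ sx.Wv := by
      intro x hx hxq
      rcases List.mem_cons.1 hx with rfl | hx
      · exact Or.inl sx.c_mem_SP
      · rcases List.mem_append.1 hx with hx | hx
        · exact Or.inr hx
        · exact absurd (List.mem_singleton.1 hx) hxq
    by_cases haq : a = sx.q₁
    · exact Or.inr (aux b hb fun hbq => hab (haq.trans hbq.symm))
    · exact Or.inl (aux a ha haq)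

/-- Structure edges touch `D̄`. [cite: NewmanTassionWu2017, §3.2 (proof of Theorem 3.7)] -/
theorem structEdges_touch : sx.structEdges ⊆ touch k sx.D := by
  intro e he
  induction e using Sym2.ind with
  | h a b =>
    rcases sx.structEdges_Wv he with h | h
    · exact mk_mem_touch_iff.2 (Or.inl (sx.Wv_D h))
    · exact mk_mem_touch_iff.2 (Or.inr (sx.Wv_D h))

/-- **Locality**: off the pairs touching `D̄`, the new configuration is the old one. [cite: NewmanTassionWu2017, §3.2 (proof of Theorem 3.7)] -/
theorem mem_newConfig_iff_of_not_touch {e : Sym2 (slab 3 k)} (he : e ∉ touch k sx.D) :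
    e ∈ sx.newConfig ↔ e ∈ ω := by
  constructor
  · rintro ((h | h) | h)
    · exact h.1
    · exact absurd (sx.structEdges_touch h) he
    · exact absurd (sx.stubs_touch h) he
  · exact fun h => Or.inl (Or.inl ⟨h, he⟩)

/-- An old open edge between vertices off `D̄` stays open. [cite: NewmanTassionWu2017, §3.2 (proof of Theorem 3.7)] -/
theorem mem_newConfig_of_off {a b : slab 3 k} (hab : s(a, b) ∈ ω) (ha : planar k a ∉ sx.D)
    (hb : planar k b ∉ sx.D) : s(a, b) ∈ sx.newConfig :=
  (sx.mem_newConfig_iff_of_not_touch (by simp [ha, hb])).2 hab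

/-- `ω' ⊆ ω ∪ Enew`. [cite: NewmanTassionWu2017, §3.2 (proof of Theorem 3.7)] -/
theorem newConfig_subset (hA : ω ∈ Q.evAB k) : sx.newConfig ⊆ ω ∪ sx.structEdges := by
  rintro e ((h | h) | h)
  · exact Or.inl h.1
  · exact Or.inr h
  · exact Or.inl (sx.stubs_subset hA h)

/-- The new configuration is a lattice configuration. [cite: NewmanTassionWu2017, §3.2 (proof of Theorem 3.7)] -/
theorem newConfig_lattice (hω : ω ⊆ (slabGraph 3 k).edgeSet) (hA : ω ∈ Q.evAB k) :
    sx.newConfig ⊆ (slabGraph 3 k).edgeSet := by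
  intro e he
  rcases sx.newConfig_subset hA he with h | (h | h)
  · exact hω h
  · exact edgesOf_subset_edgeSet sx.hSPchain h
  · exact edgesOf_subset_edgeSet sx.hBchain h

/-- Structure edges are open in the new configuration. [cite: NewmanTassionWu2017, §3.2 (proof of Theorem 3.7)] -/
theorem structEdges_subset_newConfig : sx.structEdges ⊆ sx.newConfig := fun _ h => Or.inl (Or.inr h)

/-- Stubs are open in the new configuration. [cite: NewmanTassionWu2017, §3.2 (proof of Theorem 3.7)] -/
theorem stubs_subset_newConfig : sx.stubs ⊆ sx.newConfig := fun _ h => Or.inr h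

/-- The stub into `E₁` is open. [cite: NewmanTassionWu2017, §3.2 (proof of Theorem 3.7)] -/
theorem stub₁_mem : s(sx.p₀.getLast sx.hp₀, sx.E₁) ∈ sx.newConfig :=
  sx.stubs_subset_newConfig (Or.inl rfl)

/-- The stub out of `E₂` is open. [cite: NewmanTassionWu2017, §3.2 (proof of Theorem 3.7)] -/
theorem stub₂_mem : s(sx.E₂, sx.s₀.head sx.hs₀) ∈ sx.newConfig :=
  sx.stubs_subset_newConfig (Or.inr rfl)

/-- A new-open pair at a vertex of `D̄` is a structure edge or a stub. [cite: NewmanTassionWu2017, §3.2 (proof of Theorem 3.7)] -/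
theorem edge_at_D {q x : slab 3 k} (h : s(q, x) ∈ sx.newConfig) (hx : planar k x ∈ sx.D) :
    s(q, x) ∈ sx.structEdges ∨ s(q, x) ∈ sx.stubs := by
  rcases h with ((h | h) | h)
  · exact absurd (mk_mem_touch_iff.2 (Or.inr hx)) h.2
  · exact Or.inl h
  · exact Or.inr h

/-- **Every new-open edge into `D̄` ends at a protected vertex.** [cite: NewmanTassionWu2017, §3.2 (proof of Theorem 3.7)] -/
theorem mem_Wv_of_edge {q x : slab 3 k} (h : s(q, x) ∈ sx.newConfig) (hx : planar k x ∈ sx.D) :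
    x ∈ sx.Wv := by
  rcases sx.edge_at_D h hx with h | h
  · exact sx.mem_Wv_of_Sw_D (sx.structEdges_Sw h).2 hx
  · rcases sx.stubs_cases_D h hx with ⟨rfl, -⟩ | ⟨rfl, -⟩
    · exact Or.inl sx.E₁_mem_SP
    · exact Or.inl sx.E₂_mem_SP

/-- New-open edges into protected vertices come from structure vertices, except the two stubs
into `E₁` and `E₂`. [cite: NewmanTassionWu2017, §3.2 (proof of Theorem 3.7)] -/
theorem edge_into_Wv {t x : slab 3 k} (h : s(t, x) ∈ sx.newConfig) (hx : x ∈ sx.Wv) :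
    t ∈ sx.Sw ∨ x ∈ ({sx.E₁, sx.E₂} : Set (slab 3 k)) := by
  have hxD := sx.Wv_D hx
  rcases sx.edge_at_D h hxD with h | h
  · exact Or.inl (sx.structEdges_Sw h).1
  · rcases sx.stubs_cases_D h hxD with ⟨rfl, -⟩ | ⟨rfl, -⟩
    · exact Or.inr (by simp)
    · exact Or.inr (by simp)

/-! ### The port vertex and the far side -/

/-- The port vertex lies in `(R ∖ D)‾`. [cite: NewmanTassionWu2017, §3.2 (proof of Theorem 3.7)] -/
theorem q₁_mem : sx.q₁ ∈ slabLift k (Q.R \ sx.D) := by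
  have := sx.hσ
  rw [mem_openConnIn_iff_pathIn] at this
  exact this.left_mem

/-- The port vertex is `ω`-joined to `C̄` inside `R̄`. [cite: NewmanTassionWu2017, §3.2 (proof of Theorem 3.7)] -/
theorem q₁_joined : ω ∈ openConnIn (slabLift k Q.R) sx.q₁ sx.cC :=
  openConnIn_mono (slabLift_mono k (fun _ hx => hx.1)) _ _ sx.hσ

/-- On `evX`, the port vertex is not `ω`-joined inside `R̄` to any vertex of `Ā`. [cite: NewmanTassionWu2017, §3.2 (proof of Theorem 3.7)] -/
theorem q₁_not_joined (hX : ω ∈ Q.evX k) {a : slab 3 k} (ha : a ∈ slabLift k Q.A)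
    (h : ω ∈ openConnIn (slabLift k Q.R) a sx.q₁) : False :=
  Q.not_joined_of_evX hX ha sx.hcC (SlabCriticality.openConnIn_trans h sx.q₁_joined)

/-- On `evX`, the port vertex is off `γ`. [cite: NewmanTassionWu2017, §3.2 (proof of Theorem 3.7)] -/
theorem q₁_not_mem_γ (hX : ω ∈ Q.evX k) : sx.q₁ ∉ Q.γ k ω := fun h =>
  Q.not_joined_γ_of_evX hX h sx.hcC sx.q₁_joined

/-- Membership in `γ` from membership in `p₀`. [cite: NewmanTassionWu2017, §3.2 (proof of Theorem 3.7)] -/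
theorem mem_γ_of_mem_p₀ {x : slab 3 k} (hx : x ∈ sx.p₀) : x ∈ Q.γ k ω := by
  rw [sx.hγ]; exact List.mem_append_left _ hx

/-- Membership in `γ` from membership in `s₀`. [cite: NewmanTassionWu2017, §3.2 (proof of Theorem 3.7)] -/
theorem mem_γ_of_mem_s₀ {x : slab 3 k} (hx : x ∈ sx.s₀) : x ∈ Q.γ k ω := by
  rw [sx.hγ]; simp [hx]

/-- `E₁ ∈ γ`. [cite: NewmanTassionWu2017, §3.2 (proof of Theorem 3.7)] -/
theorem E₁_mem_γ : sx.E₁ ∈ Q.γ k ω := by rw [sx.hγ]; simp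

/-- `E₂ ∈ γ`. [cite: NewmanTassionWu2017, §3.2 (proof of Theorem 3.7)] -/
theorem E₂_mem_γ : sx.E₂ ∈ Q.γ k ω := by rw [sx.hγ]; simp

/-- Vertices of `p₀` are not structure vertices. [cite: NewmanTassionWu2017, §3.2 (proof of Theorem 3.7)] -/
theorem p₀_not_Sw (hX : ω ∈ Q.evX k) {x : slab 3 k} (hx : x ∈ sx.p₀) : x ∉ sx.Sw := by
  rintro (h | rfl)
  · exact sx.hp₀D x hx (sx.Wv_D h)
  · exact sx.q₁_not_mem_γ hX (sx.mem_γ_of_mem_p₀ hx)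

/-- Vertices of `s₀` are not structure vertices. [cite: NewmanTassionWu2017, §3.2 (proof of Theorem 3.7)] -/
theorem s₀_not_Sw (hX : ω ∈ Q.evX k) {x : slab 3 k} (hx : x ∈ sx.s₀) : x ∉ sx.Sw := by
  rintro (h | rfl)
  · exact sx.hs₀D x hx (sx.Wv_D h)
  · exact sx.q₁_not_mem_γ hX (sx.mem_γ_of_mem_s₀ hx)

/-- `γ.head? = some p₀.head`. [cite: NewmanTassionWu2017, §3.2 (proof of Theorem 3.7)] -/
theorem γ_head? : (Q.γ k ω).head? = some (sx.p₀.head sx.hp₀) := by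
  rw [sx.hγ, List.head?_append, List.head?_eq_some_head sx.hp₀]; rfl

/-- `p₀.head ∈ Ā`. [cite: NewmanTassionWu2017, §3.2 (proof of Theorem 3.7)] -/
theorem p₀_head_mem_A (hA : ω ∈ Q.evAB k) : sx.p₀.head sx.hp₀ ∈ slabLift k Q.A := by
  have := (sx.γ_isOSAP hA).head_mem (by simp [sx.hp₀])
  rwa [List.head_append_of_ne_nil sx.hp₀] at this

/-- `s₀.getLast ∈ B̄`. [cite: NewmanTassionWu2017, §3.2 (proof of Theorem 3.7)] -/
theorem s₀_last_mem_B (hA : ω ∈ Q.evAB k) : sx.s₀.getLast sx.hs₀ ∈ slabLift k Q.B := by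
  have := (sx.γ_isOSAP hA).last_mem (by simp)
  rwa [List.getLast_append_of_ne_nil _ (by simp), List.getLast_cons (by simp),
    List.getLast_append_of_ne_nil _ (by simp), List.getLast_cons sx.hs₀] at this

/-- Vertices of `γ` lie in `S̄`. [cite: NewmanTassionWu2017, §3.2 (proof of Theorem 3.7)] -/
theorem γ_subset_S (hA : ω ∈ Q.evAB k) {x : slab 3 k} (hx : x ∈ Q.γ k ω) : x ∈ slabLift k Q.S :=
  (Q.γ_spec hA).1.subset x hx

/-- Every vertex of `γ` is `ω`-joined inside `R̄` to `p₀.head ∈ Ā`. [cite: NewmanTassionWu2017, §3.2 (proof of Theorem 3.7)] -/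
theorem joined_of_mem_γ (hA : ω ∈ Q.evAB k) {v : slab 3 k} (hv : v ∈ Q.γ k ω) :
    ω ∈ openConnIn (slabLift k Q.R) (sx.p₀.head sx.hp₀) v := by
  have h := Q.joined_head_of_mem_γ hA hv
  have hh : (Q.γ k ω).head (Q.γ_spec hA).1.ne_nil = sx.p₀.head sx.hp₀ := by
    rw [List.head_eq_iff_head?_eq_some, sx.γ_head?]
  rwa [hh] at h

end GlueData.Surgery

end SurgeryData

/-! ## The rerouted path and the exchange argument -/

section Exchange

namespace GlueData.Surgery

variable {k : ℕ} {Q : GlueData} {ω : BondConfig (slab 3 k)} (sx : Q.Surgery k ω)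

/-- The candidate path `T = p₀ ++ E₁ :: P ++ E₂ :: s₀`. [cite: NewmanTassionWu2017, §3.2 (proof of Theorem 3.7, the new minimal path)] -/
def T : List (slab 3 k) := sx.p₀ ++ (sx.SP ++ sx.s₀)

/-- `SP.getLast? = some E₂`. [cite: NewmanTassionWu2017, §3.2 (proof of Theorem 3.7)] -/
theorem SP_getLast? : sx.SP.getLast? = some sx.E₂ := by
  simp [SP, List.getLast?_eq_some_getLast]

/-- **`T` is an open self-avoiding path of `ω^{(z)}` from `Ā` to `B̄` inside `S̄`.**
[cite: NewmanTassionWu2017, §3.2 (proof of Theorem 3.7, "By construction, ω^{(z)} ∈ 𝒳′")] -/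
theorem isOSAP_T (hA : ω ∈ Q.evAB k) :
    IsOSAP k sx.newConfig (slabLift k Q.S) (slabLift k Q.A) (slabLift k Q.B) sx.T := by
  have hγO := sx.γ_isOSAP hA
  have hγnd := hγO.nodup
  rw [List.nodup_append] at hγnd
  obtain ⟨hp₀nd, hrestnd, hp₀rest⟩ := hγnd
  have hs₀nd : sx.s₀.Nodup :=
    (List.nodup_cons.1 (List.nodup_append.1 (List.nodup_cons.1 hrestnd).2).2.1).2
  have hγch := hγO.chain
  show IsOSAP k sx.newConfig _ _ _ (sx.p₀ ++ (sx.SP ++ sx.s₀))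
  refine ⟨?_, ?_, ?_, by simp [sx.hp₀], ?_, ?_⟩
  · -- nodup
    rw [List.nodup_append, List.nodup_append]
    refine ⟨hp₀nd, ⟨sx.hSPnodup, hs₀nd, fun a ha b hb hab => ?_⟩, fun a ha b hb hab => ?_⟩
    · exact sx.hs₀D b hb (hab ▸ sx.SP_D ha)
    · rcases List.mem_append.1 hb with hb | hb
      · exact sx.hp₀D a ha (hab ▸ sx.SP_D hb)
      · exact hp₀rest a ha b (by simp [hb]) hab
  · -- chain
    refine List.IsChain.append ?_ (List.IsChain.append ?_ ?_ ?_) ?_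
    · exact (List.isChain_append.1 hγch).1.imp_of_mem_imp fun a b ha hb h =>
        ⟨sx.mem_newConfig_of_off h.1 (sx.hp₀D a ha) (sx.hp₀D b hb), h.2⟩
    · exact isChain_of_edgesOf_subset sx.hSPchain
        (fun e he => sx.structEdges_subset_newConfig (Or.inl he))
    · exact (sx.γ_chain_s₀ hA).imp_of_mem_imp fun a b ha hb h =>
        ⟨sx.mem_newConfig_of_off h.1 (sx.hs₀D a ha) (sx.hs₀D b hb), h.2⟩
    · intro x hx y hy
      rw [sx.SP_getLast?, Option.mem_def, Option.some.injEq] at hx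
      rw [List.head?_eq_some_head sx.hs₀, Option.mem_def, Option.some.injEq] at hy
      subst hx; subst hy
      exact ⟨sx.stub₂_mem, (sx.γ_rel_E₂_s₀ hA).2⟩
    · intro x hx y hy
      rw [List.getLast?_eq_some_getLast sx.hp₀, Option.mem_def, Option.some.injEq] at hx
      have : y = sx.E₁ := by
        simp only [SP, List.cons_append, List.head?_cons, Option.mem_def, Option.some.injEq] at hy
        exact hy.symm
      subst hx; subst this
      exact ⟨sx.stub₁_mem, (sx.γ_rel_p₀_E₁ hA).2⟩
  · -- inside `S̄`
    intro x hx
    rcases List.mem_append.1 hx with hx | hx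
    · exact γ_subset_S hA (sx.mem_γ_of_mem_p₀ hx)
    rcases List.mem_append.1 hx with hx | hx
    · rcases sx.mem_SP_iff.1 hx with rfl | h | rfl
      · exact γ_subset_S hA sx.E₁_mem_γ
      · exact sx.hPS x h
      · exact γ_subset_S hA sx.E₂_mem_γ
    · exact γ_subset_S hA (sx.mem_γ_of_mem_s₀ hx)
  · -- starts in `Ā`
    intro h
    have : (sx.p₀ ++ (sx.SP ++ sx.s₀)).head h = sx.p₀.head sx.hp₀ :=
      List.head_append_of_ne_nil sx.hp₀
    rw [this]
    exact sx.p₀_head_mem_A hA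
  · -- ends in `B̄`
    intro h
    have : (sx.p₀ ++ (sx.SP ++ sx.s₀)).getLast h = sx.s₀.getLast sx.hs₀ := by
      rw [List.getLast_append_of_ne_nil _ (by simp [sx.hs₀]),
        List.getLast_append_of_ne_nil _ sx.hs₀]
    rw [this]
    exact sx.s₀_last_mem_B hA

/-- **The minimal path of `ω^{(z)}` runs through the rerouted piece**: `Γ_min(ω^{(z)}) =
p₀ ++ E₁ :: P ++ E₂ :: tail` for some `tail` (NTW: "the path `Γ(ω^{(z)})` agrees with `Γ(ω)` up
to `u′` … still goes through `v′`"), by the tree's exchange lemma `minPath_prefix_of_surgery`.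
[cite: NewmanTassionWu2017, §3.2 (proof of Theorem 3.7, "Γ(ω^{(z)}) agrees with Γ(ω) up to u′")] -/
theorem exists_tail (hX : ω ∈ Q.evX k) : ∃ tail, Q.γ k sx.newConfig = sx.p₀ ++ (sx.SP ++ tail) := by
  have hA := Q.evAB_of_evX hX
  have hS : (slabLift k Q.S).Finite := Q.S_finite
  have hex : ∃ l, IsOSAP k ω (slabLift k Q.S) (slabLift k Q.A) (slabLift k Q.B) l :=
    (mem_slabConn_iff_exists_isOSAP ω _ _ _).1 hA
  have hγ' : minPath k ω (slabLift k Q.S) (slabLift k Q.A) (slabLift k Q.B) =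
      (sx.p₀ ++ [sx.E₁]) ++ (sx.mid ++ sx.E₂ :: sx.s₀) := by
    rw [List.append_assoc]; exact sx.hγ
  have hT : IsOSAP k sx.newConfig (slabLift k Q.S) (slabLift k Q.A) (slabLift k Q.B)
      ((sx.p₀ ++ [sx.E₁]) ++ (sx.P ++ [sx.E₂]) ++ sx.s₀) := by
    have := sx.isOSAP_T hA
    convert this using 1
    simp [T, SP]
  have hγeq : minPath k ω (slabLift k Q.S) (slabLift k Q.A) (slabLift k Q.B) = Q.γ k ω := rfl
  have hpfx : ∀ x ∈ (sx.p₀ ++ [sx.E₁]).dropLast, x ∉ sx.Sw := by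
    intro x hx
    rw [List.dropLast_concat] at hx
    exact sx.p₀_not_Sw hX hx
  have h2 : ∀ q x, s(q, x) ∈ sx.newConfig → x ∈ sx.Wv →
      x ∉ minPath k ω (slabLift k Q.S) (slabLift k Q.A) (slabLift k Q.B) → q ∈ sx.Sw := by
    intro q x hqx hxW hxγ
    rcases sx.edge_into_Wv hqx hxW with h | h
    · exact h
    · exfalso
      rcases h with rfl | rfl
      · exact hxγ sx.E₁_mem_γ
      · exact hxγ sx.E₂_mem_γ
  have h4 : ∀ q ∈ sx.Sw, q ∉ sx.Wv →
      q ∉ minPath k ω (slabLift k Q.S) (slabLift k Q.A) (slabLift k Q.B) →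
      ∀ x ∈ slabLift k Q.A, ω ∉ openConnIn (slabLift k Q.S) x q := by
    intro q hq hqW _ x hx hj
    have hqw : q = sx.q₁ := by
      rcases hq with h | h
      · exact absurd h hqW
      · exact h
    subst hqw
    exact sx.q₁_not_joined hX hx (openConnIn_mono (slabLift_mono k Q.hSR) _ _ hj)
  have h5 : ∀ v ∈ sx.Wv, v ∈ slabLift k Q.A →
      v ∈ minPath k ω (slabLift k Q.S) (slabLift k Q.A) (slabLift k Q.B) ∨
      ∀ b ∈ (minPath k ω (slabLift k Q.S) (slabLift k Q.A) (slabLift k Q.B)).head?,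
        vKey k b ≤ vKey k v := by
    intro v hvW hvA
    exact absurd hvA (sx.hDA _ (sx.Wv_D hvW))
  have h9 : ∀ x ∈ (sx.P ++ [sx.E₂]).dropLast, x ∉ slabLift k Q.B := by
    intro x hx
    rw [List.dropLast_concat] at hx
    exact sx.hDB _ (sx.hPD x hx)
  have h6 : ∀ (p₁ : List (slab 3 k)) (x y : slab 3 k) (r : List (slab 3 k)),
      (sx.p₀ ++ [sx.E₁]) ++ (sx.P ++ [sx.E₂]) = p₁ ++ x :: y :: r →
      (sx.p₀ ++ [sx.E₁]).length ≤ p₁.length + 1 →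
      ∀ q, s(x, q) ∈ sx.newConfig → q ≠ y → q ∈ p₁ ∨ vKey k y < vKey k q := by
    intro p₁ x y r heq hlen q hxq hqy
    -- `p₁ = p₀ ++ p₁'` and `SP = p₁' ++ x :: y :: r`
    have heq' : sx.p₀ ++ sx.SP = p₁ ++ x :: y :: r := by
      rw [← heq]; simp [SP]
    have hlen' : sx.p₀.length ≤ p₁.length := by simpa using hlen
    obtain ⟨p₁', hp₁, hSP⟩ : ∃ p₁', p₁ = sx.p₀ ++ p₁' ∧ sx.SP = p₁' ++ x :: y :: r := by
      rcases List.append_eq_append_iff.1 heq' with ⟨a', hp₁, hSP⟩ | ⟨c', hp₀, hxyr⟩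
      · exact ⟨a', hp₁, hSP⟩
      · have : c' = [] := by
          have := congrArg List.length hp₀
          simp only [List.length_append] at this
          exact List.eq_nil_of_length_eq_zero (by omega)
        subst this
        simp only [List.append_nil] at hp₀
        simp only [List.nil_append] at hxyr
        exact ⟨[], by simp [hp₀], by simpa using hxyr.symm⟩
    have hxSP : x ∈ sx.SP := by rw [hSP]; simp
    have hxD : planar k x ∈ sx.D := sx.SP_D hxSP
    have hxq' : s(q, x) ∈ sx.newConfig := by rwa [Sym2.eq_swap]
    have hcases : s(x, q) ∈ sx.structEdges ∨ s(x, q) ∈ sx.stubs := by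
      have := sx.edge_at_D hxq' hxD
      rwa [Sym2.eq_swap] at this
    rcases hcases with (he | he) | he
    · -- an edge of `SP`: to the predecessor (`∈ p₁`) or the successor (`= y`)
      rcases next_of_mem_edgesOf sx.hSPnodup hSP he with ⟨r', hr'⟩ | ⟨l₁', hl₁'⟩
      · exact absurd (List.cons.inj hr').1.symm hqy
      · left
        rw [hp₁, hl₁']
        simp
    · -- an edge of the branch: `x = c` and `q = BQ.head`
      obtain ⟨hxB, hqB⟩ := mem_of_mem_edgesOf he
      have hxc : x = sx.c := by
        rcases List.mem_cons.1 hxB with h | h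
        · exact h
        · exact absurd hxSP (sx.BQ_not_SP h)
      subst hxc
      obtain ⟨l', hl'⟩ := eq_of_mem_edgesOf_head sx.hBnodup he
      right
      have hq : q = sx.BQ.head sx.BQ_ne_nil := by simp [BQ] at hl' ⊢; simp [hl']
      rw [hq]
      exact sx.hfwd p₁' r y hSP
    · -- a stub at `x ∈ SP`: only the one into `E₁`, from `p₀.getLast ∈ p₁`
      have he' : s(q, x) ∈ sx.stubs := by rwa [Sym2.eq_swap]
      rcases sx.stubs_cases_D he' hxD with ⟨-, rfl⟩ | ⟨hxE₂, -⟩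
      · left
        rw [hp₁]
        exact List.mem_append_left _ (List.getLast_mem _)
      · -- `x = E₂` is the last vertex of `SP`, but `y` follows it
        exfalso
        have h1 : sx.SP = (sx.E₁ :: sx.P) ++ sx.E₂ :: [] := by simp [SP]
        rw [hxE₂] at hSP
        have hE₂p : sx.E₂ ∉ p₁' := by
          intro hmem
          have hnd := sx.hSPnodup
          rw [show sx.E₁ :: (sx.P ++ [sx.E₂]) = sx.SP from rfl, hSP] at hnd
          exact (List.nodup_append.1 hnd).2.2 _ hmem _ (by simp) rfl
        have hE₂q : sx.E₂ ∉ sx.E₁ :: sx.P := by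
          intro hmem
          have hnd := sx.hSPnodup
          rw [show sx.E₁ :: (sx.P ++ [sx.E₂]) = (sx.E₁ :: sx.P) ++ [sx.E₂] by simp] at hnd
          exact (List.nodup_append.1 hnd).2.2 _ hmem _ (by simp) rfl
        obtain ⟨-, h2⟩ := split_unique (hSP.symm.trans h1) hE₂p hE₂q
        exact List.cons_ne_nil _ _ h2
  obtain ⟨tail, htail⟩ := minPath_prefix_of_surgery hS hex (sx.p₀ ++ [sx.E₁])
    (sx.mid ++ sx.E₂ :: sx.s₀) (sx.P ++ [sx.E₂]) sx.s₀ hγ' (by simp) (by simp) hT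
    sx.structEdges sx.Wv sx.Sw (sx.newConfig_subset hA) (fun a b h => sx.structEdges_Sw h)
    hpfx h2 h4 h5 h6 h9
  refine ⟨tail, ?_⟩
  change minPath k sx.newConfig _ _ _ = _
  rw [htail]; simp [SP]

end GlueData.Surgery

end Exchange

/-! ## The continuation of `Γ_min(ω^{(z)})` -/

section Recovery

namespace GlueData.Surgery

variable {k : ℕ} {Q : GlueData} {ω : BondConfig (slab 3 k)} (sx : Q.Surgery k ω)

/-- `Γ_min(ω^{(z)})` is an open self-avoiding path of `ω^{(z)}`. [cite: NewmanTassionWu2017, §3.2 (proof of Theorem 3.7)] -/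
theorem μ_isOSAP (hX : ω ∈ Q.evX k) :
    IsOSAP k sx.newConfig (slabLift k Q.S) (slabLift k Q.A) (slabLift k Q.B)
      (Q.γ k sx.newConfig) :=
  (minPath_spec Q.S_finite ⟨_, sx.isOSAP_T (Q.evAB_of_evX hX)⟩).1

/-- `ω^{(z)} ∈ evAB`. [cite: NewmanTassionWu2017, §3.2 (proof of Theorem 3.7)] -/
theorem newConfig_mem_evAB (hX : ω ∈ Q.evX k) : sx.newConfig ∈ Q.evAB k :=
  (mem_slabConn_iff_exists_isOSAP _ _ _ _).2 ⟨_, sx.isOSAP_T (Q.evAB_of_evX hX)⟩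

/-- **The continuation starts with the old exit edge**: if `Γ_min(ω^{(z)}) = p₀ ++ E₁ :: P ++
E₂ :: tail` with `tail ≠ []`, then `tail.head = s₀.head`.
[cite: NewmanTassionWu2017, §3.2 (proof of Theorem 3.7, "then agrees with Γ(ω) from v′")] -/
theorem tail_head (hX : ω ∈ Q.evX k) {tail : List (slab 3 k)}
    (hμ : Q.γ k sx.newConfig = sx.p₀ ++ (sx.SP ++ tail)) (ht : tail ≠ []) :
    tail.head ht = sx.s₀.head sx.hs₀ := by
  have hμO := sx.μ_isOSAP hX
  have hch := hμO.chain
  have hnd := hμO.nodup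
  rw [hμ] at hch hnd
  set t₁ := tail.head ht with ht₁
  have hrel : s(sx.E₂, t₁) ∈ sx.newConfig ∧ sx.E₂ ≠ t₁ := by
    have h1 := (List.isChain_append.1 hch).2.1
    have h2 := List.IsChain.rel_getLast_head_of_append h1 (by simp [SP]) ht
    have h3 : sx.SP.getLast (by simp [SP]) = sx.E₂ := by simp [SP]
    rwa [h3] at h2
  have ht₁SP : t₁ ∉ sx.SP := by
    intro h
    exact (List.nodup_append.1 (List.nodup_append.1 hnd).2.1).2.2 t₁ h t₁ (List.head_mem ht) rfl
  have hrel' : s(t₁, sx.E₂) ∈ sx.newConfig := by rw [Sym2.eq_swap]; exact hrel.1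
  rcases sx.edge_at_D hrel' sx.hE₂D with (he | he) | he
  · exfalso
    have he' : s(sx.E₂, t₁) ∈ edgesOf ((sx.E₁ :: sx.P) ++ [sx.E₂]) := by
      rw [Sym2.eq_swap]; simpa [SP] using he
    have hnd' : ((sx.E₁ :: sx.P) ++ [sx.E₂]).Nodup := by simpa [SP] using sx.hSPnodup
    obtain ⟨l₁', hl₁'⟩ := eq_of_mem_edgesOf_last hnd' he'
    apply ht₁SP
    have : t₁ ∈ sx.E₁ :: sx.P := by rw [hl₁']; simp
    simp only [SP, List.mem_cons, List.mem_append]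
    rcases List.mem_cons.1 this with h | h
    · exact Or.inl h
    · exact Or.inr (Or.inl h)
  · exfalso
    obtain ⟨-, hE₂⟩ := mem_of_mem_edgesOf he
    rcases List.mem_cons.1 hE₂ with h | h
    · exact sx.c_ne_E₂ h.symm
    · exact sx.BQ_not_SP h sx.E₂_mem_SP
  · rcases sx.stubs_cases_D he sx.hE₂D with ⟨h, -⟩ | ⟨-, h⟩
    · exact absurd h.symm sx.E₁_ne_E₂
    · exact h

/-- **The continuation lives in the old world**: every vertex of `tail` is off the structure and
`ω`-joined to `p₀.head ∈ Ā` inside `R̄`. [cite: NewmanTassionWu2017, §3.2 (proof of Theorem 3.7, recovery)] -/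
theorem tail_props (hX : ω ∈ Q.evX k) {tail : List (slab 3 k)}
    (hμ : Q.γ k sx.newConfig = sx.p₀ ++ (sx.SP ++ tail)) {q : slab 3 k} (hq : q ∈ tail) :
    q ∉ sx.Sw ∧ ω ∈ openConnIn (slabLift k Q.R) (sx.p₀.head sx.hp₀) q := by
  have hA := Q.evAB_of_evX hX
  have ht : tail ≠ [] := List.ne_nil_of_mem hq
  have hμO := sx.μ_isOSAP hX
  have hch := hμO.chain
  have hnd := hμO.nodup
  rw [hμ] at hch hnd
  obtain ⟨t₁, tail', htail⟩ := List.exists_cons_of_ne_nil ht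
  have ht₁ : t₁ = sx.s₀.head sx.hs₀ := by
    have := sx.tail_head hX hμ ht
    rw [List.head_eq_iff_head?_eq_some, htail] at this
    simpa using this
  set A : Set (slab 3 k) := slabLift k Q.S ∩ {v | v ∉ sx.SP} with hAdef
  have htailch : tail.IsChain (fun a b => s(a, b) ∈ sx.newConfig ∧ a ≠ b) :=
    (List.isChain_append.1 (List.isChain_append.1 hch).2.1).2.1
  have htailA : ∀ x ∈ tail, x ∈ A := by
    intro x hx
    refine ⟨hμO.subset x (by rw [hμ]; simp [hx]), fun hxSP => ?_⟩
    exact (List.nodup_append.1 (List.nodup_append.1 hnd).2.1).2.2 x hxSP x hx rfl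
  have hpath : sx.newConfig ∈ openConnIn A t₁ q := by
    rw [htail] at htailch htailA hq
    exact openConnIn_head_of_mem t₁ tail' htailch htailA q hq
  refine not_mem_structure_of_openConnIn (Reg := slabLift k Q.R)
    (fun x hx => slabLift_mono k Q.hSR hx.1) sx.structEdges sx.Wv sx.Sw
    {sx.E₁, sx.E₂} sx.Wv_subset (sx.p₀.head sx.hp₀) (sx.newConfig_subset hA)
    (fun a b h => sx.structEdges_Sw h) (fun t x h hx => sx.edge_into_Wv h hx) ?_ ?_ hpath ?_ ?_
  · rintro x ⟨-, hx⟩ hK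
    exfalso
    rcases hK with rfl | rfl
    · exact hx sx.E₁_mem_SP
    · exact hx sx.E₂_mem_SP
  · intro x hx hxW hj
    have hxw : x = sx.q₁ := by
      rcases hx with h | h
      · exact absurd h hxW
      · exact h
    subst hxw
    exact sx.q₁_not_joined hX (sx.p₀_head_mem_A hA) hj
  · rw [ht₁]; exact sx.s₀_not_Sw hX (List.head_mem _)
  · rw [ht₁]; exact sx.joined_of_mem_γ hA (sx.mem_γ_of_mem_s₀ (List.head_mem _))

/-- **The continuation avoids `D̄`.** [cite: NewmanTassionWu2017, §3.2 (proof of Theorem 3.7, recovery)] -/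
theorem tail_not_D (hX : ω ∈ Q.evX k) {tail : List (slab 3 k)}
    (hμ : Q.γ k sx.newConfig = sx.p₀ ++ (sx.SP ++ tail)) {q : slab 3 k} (hq : q ∈ tail) :
    planar k q ∉ sx.D := by
  intro hqD
  have ht : tail ≠ [] := List.ne_nil_of_mem hq
  obtain ⟨t₁, tail', htail⟩ := List.exists_cons_of_ne_nil ht
  have ht₁ : t₁ = sx.s₀.head sx.hs₀ := by
    have := sx.tail_head hX hμ ht
    rw [List.head_eq_iff_head?_eq_some, htail] at this
    simpa using this
  rw [htail] at hq
  rcases List.mem_cons.1 hq with rfl | hq'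
  · exact sx.s₀_head_not_D (ht₁ ▸ hqD)
  · obtain ⟨u, v, huv⟩ := List.append_of_mem hq'
    have hch := (sx.μ_isOSAP hX).chain
    rw [hμ, htail, huv] at hch
    have h1 : ((sx.p₀ ++ (sx.SP ++ t₁ :: u)) ++ q :: v).IsChain
        (fun a b => s(a, b) ∈ sx.newConfig ∧ a ≠ b) := by
      simpa [List.append_assoc] using hch
    have h2 := List.IsChain.rel_getLast_head_of_append h1 (by simp) (by simp)
    simp only [List.head_cons] at h2
    have hqW := sx.mem_Wv_of_edge h2.1 hqD
    have hq'' : q ∈ tail := by rw [htail, huv]; simp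
    exact (sx.tail_props hX hμ hq'').1 (sx.Wv_subset hqW)

/-- Every vertex of `Γ_min(ω^{(z)})` off `D̄` is `ω`-joined inside `R̄` to `p₀.head ∈ Ā`. [cite: NewmanTassionWu2017, §3.2 (proof of Theorem 3.7)] -/
theorem joined_of_mem_μ_not_D (hX : ω ∈ Q.evX k) {tail : List (slab 3 k)}
    (hμ : Q.γ k sx.newConfig = sx.p₀ ++ (sx.SP ++ tail)) {q : slab 3 k}
    (hq : q ∈ Q.γ k sx.newConfig) (hqD : planar k q ∉ sx.D) :
    ω ∈ openConnIn (slabLift k Q.R) (sx.p₀.head sx.hp₀) q := by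
  rw [hμ] at hq
  rcases List.mem_append.1 hq with h | h
  · exact sx.joined_of_mem_γ (Q.evAB_of_evX hX) (sx.mem_γ_of_mem_p₀ h)
  rcases List.mem_append.1 h with h | h
  · exact absurd (sx.SP_D h) hqD
  · exact (sx.tail_props hX hμ h).2

end GlueData.Surgery

end Recovery

/-! ## The attachment statistic and the conclusions of the surgery -/

section Attachment

variable (k : ℕ)

/-- **The recovery statistic**: the vertices `q` of `Γ_min(ω')` joined to `C̄` inside `R̄` by an
`ω'`-open path avoiding the other vertices of `Γ_min(ω')` (NTW: "`z` is the only site in the new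
minimal path `Γ(ω^{(z)})` that is connected to `C` without using any edge in `Γ(ω^{(z)})`"). A
function of `ω'` alone. [cite: NewmanTassionWu2017, §3.2 (proof of Theorem 3.7, the recovery sentence)] -/
def GlueData.att (Q : GlueData) (ω' : BondConfig (slab 3 k)) : Set (slab 3 k) :=
  {q | q ∈ Q.γ k ω' ∧ ∃ c' ∈ slabLift k Q.C,
    ω' ∈ openConnIn (slabLift k Q.R ∩ {v | v ∉ Q.γ k ω' ∨ v = q}) q c'}

namespace GlueData.Surgery

variable {k} {Q : GlueData} {ω : BondConfig (slab 3 k)} (sx : Q.Surgery k ω)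

/-- The structure path lies in `R̄`. [cite: NewmanTassionWu2017, §3.2 (proof of Theorem 3.7)] -/
theorem SP_subset_R {x : slab 3 k} (hx : x ∈ sx.SP) : x ∈ slabLift k Q.R := sx.hDR (sx.SP_D hx)

/-- The branch lies in `R̄`. [cite: NewmanTassionWu2017, §3.2 (proof of Theorem 3.7)] -/
theorem Br_subset_R {x : slab 3 k} (hx : x ∈ sx.Br) : x ∈ slabLift k Q.R := sx.hDR (sx.hBrD x hx)

/-- On `evX`, the far-side connection from the port vertex avoids `Γ_min(ω^{(z)})` and is open in
`ω^{(z)}`. [cite: NewmanTassionWu2017, §3.2 (proof of Theorem 3.7, the path π)] -/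
theorem q₁_joined_new (hX : ω ∈ Q.evX k) {tail : List (slab 3 k)}
    (hμ : Q.γ k sx.newConfig = sx.p₀ ++ (sx.SP ++ tail)) :
    sx.newConfig ∈ openConnIn (slabLift k Q.R ∩ {v | v ∉ Q.γ k sx.newConfig ∨ v = sx.c})
      sx.q₁ sx.cC := by
  have hA := Q.evAB_of_evX hX
  -- every vertex reachable from `q₁` inside `(R ∖ D)‾` is off `Γ_min(ω^{(z)})`
  have h1 : ω ∈ openConnIn (slabLift k (Q.R \ sx.D) ∩ {v | v ∉ Q.γ k sx.newConfig ∨ v = sx.c})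
      sx.q₁ sx.cC := by
    refine openConnIn_inter_of_forall sx.hσ fun v hv hjv => Or.inl fun hvμ => ?_
    have hvD : planar k v ∉ sx.D := hv.2
    have hjA := sx.joined_of_mem_μ_not_D hX hμ hvμ hvD
    have hjC : ω ∈ openConnIn (slabLift k Q.R) v sx.cC :=
      SlabCriticality.openConnIn_trans
        (openConnIn_reverse (openConnIn_mono (slabLift_mono k (fun _ hx => hx.1)) _ _ hjv))
        sx.q₁_joined
    exact Q.not_joined_of_evX hX (sx.p₀_head_mem_A hA) sx.hcC
      (SlabCriticality.openConnIn_trans hjA hjC)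
  -- the edges used are off `touch D`, hence open in `ω^{(z)}`
  have h2 : sx.newConfig ∈ openConnIn
      (slabLift k (Q.R \ sx.D) ∩ {v | v ∉ Q.γ k sx.newConfig ∨ v = sx.c}) sx.q₁ sx.cC :=
    openConnIn_of_subset_on h1 fun a ha b hb hab => sx.mem_newConfig_of_off hab ha.1.2 hb.1.2
  refine openConnIn_mono (fun x hx => ?_) _ _ h2
  exact ⟨slabLift_mono k (fun _ h => h.1) hx.1, hx.2⟩

/-- **The junction is recovered**: `c ∈ att(ω^{(z)})`, via the branch, the port edge and the far
side. [cite: NewmanTassionWu2017, §3.2 (proof of Theorem 3.7, the recovery sentence)] -/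
theorem c_mem_att (hX : ω ∈ Q.evX k) : sx.c ∈ Q.att k sx.newConfig := by
  have hA := Q.evAB_of_evX hX
  obtain ⟨tail, hμ⟩ := sx.exists_tail hX
  refine ⟨by rw [hμ]; simp [sx.c_mem_SP], sx.cC, sx.hcC, ?_⟩
  set A : Set (slab 3 k) :=
    slabLift k Q.R ∩ {v | v ∉ Q.γ k sx.newConfig ∨ v = sx.c} with hAdef
  -- the walk `c :: Br ++ [q₁]`
  have hch : (sx.c :: sx.BQ).IsChain (fun a b => s(a, b) ∈ sx.newConfig ∧ a ≠ b) :=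
    isChain_of_edgesOf_subset sx.hBchain
      fun e he => sx.structEdges_subset_newConfig (Or.inr he)
  have hsub : ∀ x ∈ sx.c :: sx.BQ, x ∈ A := by
    intro x hx
    rcases List.mem_cons.1 hx with rfl | hx
    · exact ⟨sx.SP_subset_R sx.c_mem_SP, Or.inr rfl⟩
    rcases List.mem_append.1 hx with hx | hx
    · refine ⟨sx.Br_subset_R hx, Or.inl fun hμx => ?_⟩
      rw [hμ] at hμx
      rcases List.mem_append.1 hμx with h | h
      · exact sx.hp₀D x h (sx.hBrD x hx)
      rcases List.mem_append.1 h with h | h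
      · exact sx.hBrSP x hx h
      · exact sx.tail_not_D hX hμ h (sx.hBrD x hx)
    · rw [List.mem_singleton] at hx
      subst hx
      have := sx.q₁_joined_new hX hμ
      rw [mem_openConnIn_iff_pathIn] at this
      exact this.left_mem
  have hconn := openConnIn_of_isChain _ _ hch hsub
  have hlast : (sx.c :: sx.BQ).getLast (List.cons_ne_nil _ _) = sx.q₁ := by
    simp [BQ]
  rw [hlast] at hconn
  exact SlabCriticality.openConnIn_trans hconn (sx.q₁_joined_new hX hμ)

/-- **The statistic localises the surgery**: `att(ω^{(z)}) ⊆ D̄` — a vertex of `Γ_min(ω^{(z)})`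
off `D̄` is an old-world vertex `ω`-joined to `Ā`, and an `ω^{(z)}`-open path from it to `C̄`
avoiding the rest of `Γ_min(ω^{(z)})` cannot enter the structure, so it would be `ω`-open and glue
`C` to `A` in `ω`. [cite: NewmanTassionWu2017, §3.2 (proof of Theorem 3.7, "z is the only site …")] -/
theorem att_subset (hX : ω ∈ Q.evX k) : Q.att k sx.newConfig ⊆ slabLift k sx.D := by
  have hA := Q.evAB_of_evX hX
  obtain ⟨tail, hμ⟩ := sx.exists_tail hX
  rintro q ⟨hqμ, c', hc', hj⟩
  by_contra hqD
  rw [mem_slabLift_iff] at hqD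
  have hqSw : q ∉ sx.Sw := by
    rintro (h | rfl)
    · exact hqD (sx.Wv_D h)
    · -- `q₁ ∉ Γ_min(ω^{(z)})`: it is a structure vertex off `p₀`, `SP`, `tail`
      rw [hμ] at hqμ
      rcases List.mem_append.1 hqμ with h | h
      · exact sx.p₀_not_Sw hX h sx.q₁_mem_Sw
      rcases List.mem_append.1 h with h | h
      · exact sx.q₁_not_mem_SP h
      · exact (sx.tail_props hX hμ h).1 sx.q₁_mem_Sw
  have hq0 : ω ∈ openConnIn (slabLift k Q.R) (sx.p₀.head sx.hp₀) q :=
    sx.joined_of_mem_μ_not_D hX hμ hqμ hqD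
  have hres := not_mem_structure_of_openConnIn (Reg := slabLift k Q.R)
    (A := slabLift k Q.R ∩ {v | v ∉ Q.γ k sx.newConfig ∨ v = q})
    (fun x hx => hx.1) sx.structEdges sx.Wv sx.Sw {sx.E₁, sx.E₂} sx.Wv_subset
    (sx.p₀.head sx.hp₀) (sx.newConfig_subset hA) (fun a b h => sx.structEdges_Sw h)
    (fun t x h hx => sx.edge_into_Wv h hx) ?_ ?_ hj hqSw hq0
  · exact Q.not_joined_of_evX hX (sx.p₀_head_mem_A hA) hc' hres.2
  · rintro x ⟨-, hx⟩ hK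
    exfalso
    have hxSP : x ∈ sx.SP := by
      rcases hK with rfl | rfl
      · exact sx.E₁_mem_SP
      · exact sx.E₂_mem_SP
    rcases hx with hx | rfl
    · exact hx (by rw [hμ]; simp [hxSP])
    · exact hqD (sx.SP_D hxSP)
  · intro x hx hxW hj'
    have hxw : x = sx.q₁ := by
      rcases hx with h | h
      · exact absurd h hxW
      · exact h
    subst hxw
    exact sx.q₁_not_joined hX (sx.p₀_head_mem_A hA) hj'

/-- **The new configuration realises `C ⟷^R A`** (along `γ` to `E₁`, the rerouted piece to `c`,
the branch, the port edge and the far side). [cite: NewmanTassionWu2017, §3.2 (proof of Theorem 3.7, "By construction, ω^{(z)} ∈ 𝒳′")] -/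
theorem newConfig_mem_evCA (hX : ω ∈ Q.evX k) : sx.newConfig ∈ Q.evCA k := by
  have hA := Q.evAB_of_evX hX
  obtain ⟨hcμ, c', hc', hj⟩ := sx.c_mem_att hX
  have hμO := sx.μ_isOSAP hX
  have h1 := hμO.openConnIn_of_mem hcμ
  obtain ⟨tail, hμ⟩ := sx.exists_tail hX
  have hh : (Q.γ k sx.newConfig).head hμO.ne_nil = sx.p₀.head sx.hp₀ := by
    rw [List.head_eq_iff_head?_eq_some, hμ, List.head?_append, List.head?_eq_some_head sx.hp₀]
    rfl
  rw [hh] at h1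
  have h2 : sx.newConfig ∈ openConnIn (slabLift k Q.R) c' (sx.p₀.head sx.hp₀) :=
    openConnIn_reverse (SlabCriticality.openConnIn_trans
      (openConnIn_mono (slabLift_mono k Q.hSR) _ _ h1) (openConnIn_mono (fun x hx => hx.1) _ _ hj))
  exact ⟨c', hc', sx.p₀.head sx.hp₀, sx.p₀_head_mem_A hA, h2⟩

/-- The attachment statistic of `ω^{(z)}` is non-empty. [cite: NewmanTassionWu2017, §3.2 (proof of Theorem 3.7)] -/
theorem att_nonempty (hX : ω ∈ Q.evX k) : (Q.att k sx.newConfig).Nonempty := ⟨sx.c, sx.c_mem_att hX⟩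

/-- **Recovery window**: `ω` and `ω^{(z)}` agree off the pairs touching `D̄`. [cite: NewmanTassionWu2017, §3.2 (proof of Theorem 3.7)] -/
theorem agree_off_touch {e : Sym2 (slab 3 k)} (he : e ∉ touch k sx.D) : (e ∈ ω ↔ e ∈ sx.newConfig) :=
  (sx.mem_newConfig_iff_of_not_touch he).symm

end GlueData.Surgery

end Attachment

end NTW17

end Literature.Probability.Percolation
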